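import Summits.HubbardSuperconductivity.HubbardSuperconductivity.Theorems.KacWindowPenaltyWindowGapMonotone
import Summits.HubbardSuperconductivity.HubbardSuperconductivity.Theorems.KacWindowPenaltyWindowGapPenalisedForms

/-!
# Route `KacWindowPenalty` — crux `WindowGap` (stmt-HubbardSuperconductivity-1088): the parabolic descent

Supports for the crux, line `parabolic-descent` (crux idea card
`Cruxes/WindowGap/Ideas/parabolic-descent.md`, registered skeleton `Cruxes/WindowGap/Lines/Sketch.lean`).
The line transports ONE penalised-energy inequality at ONE window scale `(ε⋆, λ⋆)` down the
parabola `(ε_k, λ_k) = (ε⋆ 2^{-k}, λ⋆ 4^{-k})` (the scaling forced by the landed negative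
`not_windowGap_uniform`), paying at level `k` only the dyadic-ANNULUS weight of one minimiser of the
level-`(k+1)` problem. Everything here is ABSTRACT — arbitrary square complex matrices `H`
(Hamiltonian) and `W, W'` (penalties), a subspace `K` (sector), and then an arbitrary FAMILY of such
systems indexed by a type `ι` with a size `size : ι → ℕ`, a side condition `good : ι → Prop` and a
weight `wt : ι → ℝ`; the crux's objects (`hubbardTorus 2 L 1 U`, the Kac window `W_ε`,
`szSector N_L 0`, `wt = L²`, `good = Even`) are one instance, assembled in the skeleton:

* `windowGap_descent_step` — if `λA ≤ minE(H + λW | K) − minE(H | K)`, `0 < λ' ≤ λ` and `ψ` is a unit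
  minimiser of `H + λ'W'` on `K`, then `λ'(A − Re⟨ψ,(W − W')ψ⟩) ≤ minE(H + λ'W' | K) − minE(H | K)`
  (chord monotonicity of the concave penalised energy, `windowGapIneq_mono_lam`, then the
  variational principle for `H + λ'W` at `ψ`);
* `windowGap_descent_cascade` — iterating along couplings `λ/4^k` and penalties `W k`:
  `(λ/4^K)(A − Σ_{k<K} b_k) ≤ minE(H + (λ/4^K) W K | K) − minE(H | K)` given, for each `k < K`, a unit
  minimiser of level `k+1` with `Re⟨ψ,(W k − W (k+1))ψ⟩ ≤ b_k`;
* `windowGap_mul_re_expect_le_gain`, `windowGap_exists_minimiser_re_expect_le_of_gain` — the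
  expectation of `A` in a minimiser of `X` is at most `(minE(X | K) − minE(X − μA | K))/μ` for every
  `μ > 0` (variational principle for `X − μA`), so GAIN ceilings supply the annulus bounds;
* `windowGap_family_cascade`, `windowGapAt_family_of_base_annulus`,
  `windowGapAt_family_of_base_gain` — the same along a family with thresholds `∃ L₀, ∀ i, L₀ ≤ size i →
  good i → …`, ending in the crux's quantifier shape `∀ C ≥ 0, ∀ ε₀ > 0, ∃ ε ∈ (0, ε₀], ∃ λ, a > 0,
  ∃ L₀, …, λ(Cε + a)·wt i ≤ minE(H_i + λ W_i(ε) | K_i) − minE(H_i | K_i)` with `ε = ε⋆/2^K`,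
  `λ = λ⋆/4^K`, `a = a₀` whenever the budget leaves `2a₀ ≤ A⋆ − Σ_{k<K} b_k` at every `K`.

No definitions, no named facts, no physics (the physics of the line is its BASE certificate and its
annulus/gain ceilings, the skeleton's `stub_localCertificate`). Sources: H. Tasaki, *Physics and
Mathematics of Quantum Many-Body Systems* (2020) §2.1 (variational principle); Wang et al.,
arXiv:2310.05844, §II (certified expectation values from energy differences).
-/

-- the mandated namespace `Summit.<Summit>.<Problem>.Theorems` repeats `HubbardSuperconductivity`
-- (single-problem summit, D-0017), which the `dupNamespace` linter flags on every declaration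
set_option linter.dupNamespace false

namespace Summit.HubbardSuperconductivity.HubbardSuperconductivity.Theorems

open Matrix

section Single

variable {n : Type*} [Fintype n]

/-- **Descent step.** For matrices `H, W, W'`, a subspace `K`, couplings `0 < λ' ≤ λ`, a gap
`λ A ≤ minE(H + λW | K) − minE(H | K)` and ANY unit minimiser `ψ` of `H + λ'W'` on `K`:
`λ'(A − Re⟨ψ,(W − W')ψ⟩) ≤ minE(H + λ'W' | K) − minE(H | K)`. Proof: chord monotonicity in the
coupling (`windowGapIneq_mono_lam`) brings the gap down to `λ'`, and the variational principle for
`H + λ'W` at `ψ` reads `minE(H + λ'W | K) ≤ Re⟨ψ,(H + λ'W')ψ⟩ + λ' Re⟨ψ,(W − W')ψ⟩`.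
Tasaki (2020) §2.1. [folklore] -/
theorem windowGap_descent_step (H W W' : Matrix n n ℂ) (K : Submodule ℂ (n → ℂ)) {lam lam' A : ℝ}
    (hlam' : 0 < lam') (hle : lam' ≤ lam)
    (hgap : lam * A ≤ (H + (lam : ℂ) • W).minEnergyOn K - H.minEnergyOn K)
    {ψ : n → ℂ} (hψK : ψ ∈ K) (hψ : star ψ ⬝ᵥ ψ = 1)
    (hmin : (star ψ ⬝ᵥ (H + (lam' : ℂ) • W') *ᵥ ψ).re = (H + (lam' : ℂ) • W').minEnergyOn K) :
    lam' * (A - (star ψ ⬝ᵥ (W - W') *ᵥ ψ).re) ≤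
      (H + (lam' : ℂ) • W').minEnergyOn K - H.minEnergyOn K := by
  have h1 := windowGapIneq_mono_lam H W K hlam' hle hgap
  have h2 := minEnergyOn_le_re_rayleigh (H + (lam' : ℂ) • W) K hψK hψ
  rw [add_mulVec, dotProduct_add, Complex.add_re, smul_mulVec, dotProduct_smul, smul_eq_mul,
    Complex.re_ofReal_mul] at h2 hmin
  rw [sub_mulVec, dotProduct_sub, Complex.sub_re, mul_sub, mul_sub]
  linarith

/-- **Descent cascade (one system, `K` levels).** Penalties `W k` at the levels `k = 0, 1, …`,
couplings `λ/4^k`. If `λ A ≤ minE(H + λ W 0 | K) − minE(H | K)` and for every `k < K` SOME unit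
minimiser `ψ` of `H + (λ/4^{k+1}) W (k+1)` on `K` has annulus weight `Re⟨ψ,(W k − W (k+1))ψ⟩ ≤ b_k`,
then `(λ/4^K)(A − Σ_{k<K} b_k) ≤ minE(H + (λ/4^K) W K | K) − minE(H | K)` (induction on `K` from
`windowGap_descent_step`). Tasaki (2020) §2.1. [folklore] -/
theorem windowGap_descent_cascade (H : Matrix n n ℂ) (W : ℕ → Matrix n n ℂ)
    (K : Submodule ℂ (n → ℂ)) {lam A : ℝ} (hlam : 0 < lam) (b : ℕ → ℝ)
    (hgap : lam * A ≤ (H + (lam : ℂ) • W 0).minEnergyOn K - H.minEnergyOn K) (Kl : ℕ)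
    (hstep : ∀ k < Kl, ∃ ψ ∈ K, star ψ ⬝ᵥ ψ = 1 ∧
      (star ψ ⬝ᵥ (H + ((lam / 4 ^ (k + 1) : ℝ) : ℂ) • W (k + 1)) *ᵥ ψ).re =
        (H + ((lam / 4 ^ (k + 1) : ℝ) : ℂ) • W (k + 1)).minEnergyOn K ∧
      (star ψ ⬝ᵥ (W k - W (k + 1)) *ᵥ ψ).re ≤ b k) :
    lam / 4 ^ Kl * (A - ∑ k ∈ Finset.range Kl, b k) ≤
      (H + ((lam / 4 ^ Kl : ℝ) : ℂ) • W Kl).minEnergyOn K - H.minEnergyOn K := by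
  induction Kl with
  | zero => simpa using hgap
  | succ Kl ih =>
    have ih' := ih fun k hk => hstep k (Nat.lt_succ_of_lt hk)
    obtain ⟨ψ, hψK, hψ, hmin, hann⟩ := hstep Kl (Nat.lt_succ_self Kl)
    have hlamK : 0 < lam / 4 ^ (Kl + 1) := by positivity
    have hle : lam / 4 ^ (Kl + 1) ≤ lam / 4 ^ Kl :=
      div_le_div_of_nonneg_left hlam.le (by positivity)
        (pow_le_pow_right₀ (by norm_num) (Nat.le_succ Kl))
    have step := windowGap_descent_step H (W Kl) (W (Kl + 1)) K hlamK hle ih' hψK hψ hmin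
    rw [Finset.sum_range_succ]
    have hkey : lam / 4 ^ (Kl + 1) * (A - (∑ k ∈ Finset.range Kl, b k + b Kl)) ≤
        lam / 4 ^ (Kl + 1) *
          (A - ∑ k ∈ Finset.range Kl, b k - (star ψ ⬝ᵥ (W Kl - W (Kl + 1)) *ᵥ ψ).re) := by
      apply mul_le_mul_of_nonneg_left _ hlamK.le
      linarith
    exact hkey.trans step

/-- **Expectation in a minimiser ≤ gain/μ.** If `ψ` is a unit minimiser of `X` on `K`, then for
every real `μ`, `μ Re⟨ψ, Aψ⟩ ≤ minE(X | K) − minE(X − μA | K)` (the variational principle for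
`X − μA` at `ψ`). Wang et al., arXiv:2310.05844, §II; Tasaki (2020) §2.1. [folklore] -/
theorem windowGap_mul_re_expect_le_gain (X A : Matrix n n ℂ) (K : Submodule ℂ (n → ℂ)) {μ : ℝ}
    {ψ : n → ℂ} (hψK : ψ ∈ K) (hψ : star ψ ⬝ᵥ ψ = 1)
    (hmin : (star ψ ⬝ᵥ X *ᵥ ψ).re = X.minEnergyOn K) :
    μ * (star ψ ⬝ᵥ A *ᵥ ψ).re ≤ X.minEnergyOn K - (X - (μ : ℂ) • A).minEnergyOn K := by
  have h := minEnergyOn_le_re_rayleigh (X - (μ : ℂ) • A) K hψK hψ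
  rw [sub_mulVec, dotProduct_sub, Complex.sub_re, smul_mulVec, dotProduct_smul, smul_eq_mul,
    Complex.re_ofReal_mul, hmin] at h
  linarith

/-- **Gain ceilings supply annulus bounds.** If `K` contains a unit vector, `μ > 0` and the
attractive perturbation `−μA` gains at most `μB` (`minE(X | K) − minE(X − μA | K) ≤ μB`), then SOME
unit minimiser `ψ` of `X` on `K` has `Re⟨ψ, Aψ⟩ ≤ B` (minimisers exist:
`exists_unit_re_rayleigh_eq_minEnergyOn`; then `windowGap_mul_re_expect_le_gain`).
Wang et al., arXiv:2310.05844, §II. [folklore] -/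
theorem windowGap_exists_minimiser_re_expect_le_of_gain (X A : Matrix n n ℂ)
    (K : Submodule ℂ (n → ℂ)) (hK : ∃ φ ∈ K, star φ ⬝ᵥ φ = 1) {μ B : ℝ} (hμ : 0 < μ)
    (hgain : X.minEnergyOn K - (X - (μ : ℂ) • A).minEnergyOn K ≤ μ * B) :
    ∃ ψ ∈ K, star ψ ⬝ᵥ ψ = 1 ∧ (star ψ ⬝ᵥ X *ᵥ ψ).re = X.minEnergyOn K ∧
      (star ψ ⬝ᵥ A *ᵥ ψ).re ≤ B := by
  obtain ⟨ψ, hψK, hψ, hmin⟩ := exists_unit_re_rayleigh_eq_minEnergyOn X K hK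
  refine ⟨ψ, hψK, hψ, hmin, ?_⟩
  have h := (windowGap_mul_re_expect_le_gain X A K hψK hψ hmin).trans hgain
  exact le_of_mul_le_mul_left h hμ

end Single

section Family

/-- **Descent cascade along a family.** Systems `(H_i, W_i(ε), K_i)` indexed by `i : ι` with size
`size i`, side condition `good i` and weight `wt i`; BASE `λ⋆A⋆·wt i ≤ minE(H_i + λ⋆W_i(ε⋆) | K_i) −
minE(H_i | K_i)` for all large good `i`, and ANNULUS LAW: for every level `k` and all large good `i`
some unit minimiser of `H_i + (λ⋆/4^{k+1}) W_i(ε⋆/2^{k+1})` on `K_i` has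
`Re⟨ψ,(W_i(ε⋆/2^k) − W_i(ε⋆/2^{k+1}))ψ⟩ ≤ b_k·wt i`. Then at every level `K`, for all large good `i`,
`(λ⋆/4^K)(A⋆ − Σ_{k<K} b_k)·wt i ≤ minE(H_i + (λ⋆/4^K) W_i(ε⋆/2^K) | K_i) − minE(H_i | K_i)`
(`windowGap_descent_cascade` at each `i` beyond the maximum of the finitely many thresholds).
Tasaki (2020) §2.1. [folklore] -/
theorem windowGap_family_cascade {ι : Type*} {n : ι → Type*} [∀ i, Fintype (n i)]
    (size : ι → ℕ) (good : ι → Prop) (wt : ι → ℝ)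
    (H : ∀ i, Matrix (n i) (n i) ℂ) (W : ∀ i, ℝ → Matrix (n i) (n i) ℂ)
    (K : ∀ i, Submodule ℂ (n i → ℂ)) {εs lams As : ℝ} {b : ℕ → ℝ} (hlam : 0 < lams)
    (hbase : ∃ L₀ : ℕ, ∀ i, L₀ ≤ size i → good i →
      lams * As * wt i ≤ (H i + (lams : ℂ) • W i εs).minEnergyOn (K i) - (H i).minEnergyOn (K i))
    (hann : ∀ k : ℕ, ∃ L₀ : ℕ, ∀ i, L₀ ≤ size i → good i → ∃ ψ ∈ K i, star ψ ⬝ᵥ ψ = 1 ∧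
      (star ψ ⬝ᵥ (H i + ((lams / 4 ^ (k + 1) : ℝ) : ℂ) • W i (εs / 2 ^ (k + 1))) *ᵥ ψ).re =
        (H i + ((lams / 4 ^ (k + 1) : ℝ) : ℂ) • W i (εs / 2 ^ (k + 1))).minEnergyOn (K i) ∧
      (star ψ ⬝ᵥ (W i (εs / 2 ^ k) - W i (εs / 2 ^ (k + 1))) *ᵥ ψ).re ≤ b k * wt i)
    (Kl : ℕ) :
    ∃ L₀ : ℕ, ∀ i, L₀ ≤ size i → good i →
      lams / 4 ^ Kl * (As - ∑ k ∈ Finset.range Kl, b k) * wt i ≤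
        (H i + ((lams / 4 ^ Kl : ℝ) : ℂ) • W i (εs / 2 ^ Kl)).minEnergyOn (K i) -
          (H i).minEnergyOn (K i) := by
  obtain ⟨L₀, h₀⟩ := hbase
  choose Lk hLk using hann
  refine ⟨max L₀ ((Finset.range Kl).sup Lk), fun i hi hg => ?_⟩
  have hi₀ : L₀ ≤ size i := le_of_max_le_left hi
  have hik : ∀ k < Kl, Lk k ≤ size i := fun k hk =>
    (Finset.le_sup (f := Lk) (Finset.mem_range.2 hk)).trans (le_of_max_le_right hi)
  have hgap : lams * (As * wt i) ≤
      (H i + (lams : ℂ) • W i (εs / 2 ^ 0)).minEnergyOn (K i) - (H i).minEnergyOn (K i) := by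
    rw [pow_zero, div_one, ← mul_assoc]
    exact h₀ i hi₀ hg
  have hc := windowGap_descent_cascade (H i) (fun k => W i (εs / 2 ^ k)) (K i) hlam
    (fun k => b k * wt i) hgap Kl (fun k hk => hLk k i (hik k hk) hg)
  have hsum : As * wt i - ∑ k ∈ Finset.range Kl, b k * wt i =
      (As - ∑ k ∈ Finset.range Kl, b k) * wt i := by
    rw [← Finset.sum_mul]; ring
  rw [hsum, ← mul_assoc] at hc
  exact hc

/-- **The crux's quantifier shape from BASE + ANNULUS LAW + BUDGET, along a family.** With
nonnegative weights, `ε⋆, λ⋆, a₀ > 0` and a budget leaving `2a₀ ≤ A⋆ − Σ_{k<K} b_k` at every `K`: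
for every tail allowance `C ≥ 0` and `ε₀ > 0` there are `ε ∈ (0, ε₀]` (namely `ε⋆/2^K` with
`ε ≤ min ε₀ (a₀/(C+1))`, so that `Cε ≤ a₀`), `λ = λ⋆/4^K`, `a = a₀` and a threshold beyond which
`λ(Cε + a)·wt i ≤ minE(H_i + λW_i(ε) | K_i) − minE(H_i | K_i)` for all good `i`
(`windowGap_family_cascade` at level `K`). This is the composition of line `parabolic-descent` for the
crux `WindowGap`, whose instance is `H_i = hubbardTorus 2 L 1 U`, `W_i(ε)` the Kac-window pair penalty,
`K_i = szSector N_L 0`, `wt = L²`, `good = Even`. Tasaki (2020) §2.1. [folklore] -/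
theorem windowGapAt_family_of_base_annulus {ι : Type*} {n : ι → Type*} [∀ i, Fintype (n i)]
    (size : ι → ℕ) (good : ι → Prop) (wt : ι → ℝ)
    (H : ∀ i, Matrix (n i) (n i) ℂ) (W : ∀ i, ℝ → Matrix (n i) (n i) ℂ)
    (K : ∀ i, Submodule ℂ (n i → ℂ)) {εs lams As a₀ : ℝ} {b : ℕ → ℝ}
    (hwt : ∀ i, 0 ≤ wt i) (hε : 0 < εs) (hlam : 0 < lams) (ha₀ : 0 < a₀)
    (hbase : ∃ L₀ : ℕ, ∀ i, L₀ ≤ size i → good i →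
      lams * As * wt i ≤ (H i + (lams : ℂ) • W i εs).minEnergyOn (K i) - (H i).minEnergyOn (K i))
    (hann : ∀ k : ℕ, ∃ L₀ : ℕ, ∀ i, L₀ ≤ size i → good i → ∃ ψ ∈ K i, star ψ ⬝ᵥ ψ = 1 ∧
      (star ψ ⬝ᵥ (H i + ((lams / 4 ^ (k + 1) : ℝ) : ℂ) • W i (εs / 2 ^ (k + 1))) *ᵥ ψ).re =
        (H i + ((lams / 4 ^ (k + 1) : ℝ) : ℂ) • W i (εs / 2 ^ (k + 1))).minEnergyOn (K i) ∧
      (star ψ ⬝ᵥ (W i (εs / 2 ^ k) - W i (εs / 2 ^ (k + 1))) *ᵥ ψ).re ≤ b k * wt i)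
    (hbudget : ∀ Kl : ℕ, 2 * a₀ ≤ As - ∑ k ∈ Finset.range Kl, b k) :
    ∀ C : ℝ, 0 ≤ C → ∀ ε₀ : ℝ, 0 < ε₀ → ∃ ε ∈ Set.Ioc (0 : ℝ) ε₀, ∃ lam a : ℝ, 0 < lam ∧ 0 < a ∧
      ∃ L₀ : ℕ, ∀ i, L₀ ≤ size i → good i →
        lam * (C * ε + a) * wt i ≤
          (H i + (lam : ℂ) • W i ε).minEnergyOn (K i) - (H i).minEnergyOn (K i) := by
  intro C hC ε₀ hε₀
  -- choose the level: `εs / 2^K ≤ min ε₀ (a₀ / (C+1))`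
  obtain ⟨Kl, hK⟩ : ∃ Kl : ℕ, εs / 2 ^ Kl ≤ min ε₀ (a₀ / (C + 1)) := by
    have hpos : 0 < min ε₀ (a₀ / (C + 1)) := lt_min hε₀ (div_pos ha₀ (by linarith))
    obtain ⟨Kl, hK⟩ :=
      pow_unbounded_of_one_lt (εs / min ε₀ (a₀ / (C + 1))) (by norm_num : (1 : ℝ) < 2)
    refine ⟨Kl, ?_⟩
    rw [div_le_iff₀ (by positivity)]
    rw [div_lt_iff₀ hpos] at hK
    linarith
  obtain ⟨L₀, hL⟩ := windowGap_family_cascade size good wt H W K hlam hbase hann Kl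
  refine ⟨εs / 2 ^ Kl, ⟨by positivity, hK.trans (min_le_left _ _)⟩, lams / 4 ^ Kl, a₀,
    by positivity, ha₀, L₀, fun i hi hg => ?_⟩
  have h := hL i hi hg
  have hCε : C * (εs / 2 ^ Kl) ≤ a₀ := by
    have h1 : εs / 2 ^ Kl ≤ a₀ / (C + 1) := hK.trans (min_le_right _ _)
    have h2 : C * (εs / 2 ^ Kl) ≤ C * (a₀ / (C + 1)) := mul_le_mul_of_nonneg_left h1 hC
    have h3 : C * (a₀ / (C + 1)) ≤ a₀ := by
      rw [mul_div_assoc', div_le_iff₀ (by linarith)]; nlinarith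
    linarith
  have hb := hbudget Kl
  have hlamK : 0 ≤ lams / 4 ^ Kl := by positivity
  calc lams / 4 ^ Kl * (C * (εs / 2 ^ Kl) + a₀) * wt i
      ≤ lams / 4 ^ Kl * (As - ∑ k ∈ Finset.range Kl, b k) * wt i := by
        apply mul_le_mul_of_nonneg_right _ (hwt i)
        exact mul_le_mul_of_nonneg_left (by linarith) hlamK
    _ ≤ _ := h

/-- **The crux's quantifier shape from BASE + GAIN CEILINGS + BUDGET, along a family** (the
all-energy form: the annulus law is supplied by `windowGap_exists_minimiser_re_expect_le_of_gain`
from, per level `k`, one `μ_k > 0` with `minE(X | K_i) − minE(X − μ_k(W_i(ε⋆/2^k) − W_i(ε⋆/2^{k+1})) | K_i)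
≤ μ_k b_k·wt i` for all large good `i`, `X = H_i + (λ⋆/4^{k+1}) W_i(ε⋆/2^{k+1})`, provided the
sectors `K_i` eventually contain unit vectors). Wang et al., arXiv:2310.05844, §II; Tasaki (2020)
§2.1. [folklore] -/
theorem windowGapAt_family_of_base_gain {ι : Type*} {n : ι → Type*} [∀ i, Fintype (n i)]
    (size : ι → ℕ) (good : ι → Prop) (wt : ι → ℝ)
    (H : ∀ i, Matrix (n i) (n i) ℂ) (W : ∀ i, ℝ → Matrix (n i) (n i) ℂ)
    (K : ∀ i, Submodule ℂ (n i → ℂ)) {εs lams As a₀ : ℝ} {b : ℕ → ℝ}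
    (hwt : ∀ i, 0 ≤ wt i) (hε : 0 < εs) (hlam : 0 < lams) (ha₀ : 0 < a₀)
    (hK : ∃ L₀ : ℕ, ∀ i, L₀ ≤ size i → good i → ∃ φ ∈ K i, star φ ⬝ᵥ φ = 1)
    (hbase : ∃ L₀ : ℕ, ∀ i, L₀ ≤ size i → good i →
      lams * As * wt i ≤ (H i + (lams : ℂ) • W i εs).minEnergyOn (K i) - (H i).minEnergyOn (K i))
    (hgain : ∀ k : ℕ, ∃ μ : ℝ, 0 < μ ∧ ∃ L₀ : ℕ, ∀ i, L₀ ≤ size i → good i →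
      (H i + ((lams / 4 ^ (k + 1) : ℝ) : ℂ) • W i (εs / 2 ^ (k + 1))).minEnergyOn (K i) -
        (H i + ((lams / 4 ^ (k + 1) : ℝ) : ℂ) • W i (εs / 2 ^ (k + 1)) -
          (μ : ℂ) • (W i (εs / 2 ^ k) - W i (εs / 2 ^ (k + 1)))).minEnergyOn (K i) ≤
        μ * b k * wt i)
    (hbudget : ∀ Kl : ℕ, 2 * a₀ ≤ As - ∑ k ∈ Finset.range Kl, b k) :
    ∀ C : ℝ, 0 ≤ C → ∀ ε₀ : ℝ, 0 < ε₀ → ∃ ε ∈ Set.Ioc (0 : ℝ) ε₀, ∃ lam a : ℝ, 0 < lam ∧ 0 < a ∧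
      ∃ L₀ : ℕ, ∀ i, L₀ ≤ size i → good i →
        lam * (C * ε + a) * wt i ≤
          (H i + (lam : ℂ) • W i ε).minEnergyOn (K i) - (H i).minEnergyOn (K i) := by
  refine windowGapAt_family_of_base_annulus size good wt H W K hwt hε hlam ha₀ hbase ?_ hbudget
  intro k
  obtain ⟨μ, hμ, L₁, h₁⟩ := hgain k
  obtain ⟨L₂, h₂⟩ := hK
  refine ⟨max L₁ L₂, fun i hi hg => ?_⟩
  have hg1 := h₁ i (le_of_max_le_left hi) hg
  have hmu : μ * b k * wt i = μ * (b k * wt i) := mul_assoc _ _ _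
  rw [hmu] at hg1
  exact windowGap_exists_minimiser_re_expect_le_of_gain _ _ (K i) (h₂ i (le_of_max_le_right hi) hg)
    hμ hg1

end Family

end Summit.HubbardSuperconductivity.HubbardSuperconductivity.Theorems
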